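import Literature.Analysis.FluidPDE.TorusWordLeibniz
import Literature.Analysis.FunctionSpaces.TorusSobolevSup
import HarnessLib

/-!
# Word energies of smooth fields on `𝕋³` and the sup bound `‖∂^w f‖²_∞ ≤ K E_{|w|+2}(f)`

Analysis/FluidPDE support file (everything proved; no named facts), sequel of `TorusWordLeibniz`.
For a smooth `f : 𝕋^d → F'` the **word energy of order `n`** is
`wordEnergy n f = ∑_{v : Fin n → d} ∫ ‖∂^{v} f‖²` (sum over all words of length `n`, written as
functions `Fin n → d` and realised as lists by `List.ofFn`), and the **Sobolev energy of order
`m`** is `sobolevEnergy m f = ∑_{n ≤ m} wordEnergy n f` (Majda 1984, Ch. 2, (2.8): the square of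
the `H^m` norm written with all ordered derivative words). This file records the elementary
bookkeeping (`wordEnergy_zero`, `wordEnergy_succ'`: `E_{n+1}(f) = ∑ᵤ ∑ᵢ ∫‖∂ᵢ∂^u f‖²`, nonnegativity,
single words and their extensions against the energies) and combines it with the tree's Sobolev
embedding `H²(𝕋³) ⊂ L^∞` (`Torus.exists_norm_sq_le_sobolev_two`, `TorusSobolevSup`) into the
word-level sup bound

* `exists_norm_sq_wordDeriv_le` — there is `K > 0` (depending only on the target space) with
  `‖∂^w f (x)‖² ≤ K (E_n(f) + E_{n+1}(f) + E_{n+2}(f))`, `n = |w|`, for every smooth `f : 𝕋³ → F'`,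
  every word `w` and every point `x`;

the basic tool turning `H^{m}` energies into `C^{m-2}` bounds in energy estimates of arbitrary
order (Majda 1984, Ch. 2 §2.1, proof of Thm 2.2).

## References

* A. Majda, *Compressible Fluid Flow and Systems of Conservation Laws in Several Space
  Variables*, Springer 1984, Ch. 2 §2.1, (2.8) and Prop. 2.1. [`Majda1984`]
* R. A. Adams, *Sobolev Spaces*, Academic Press 1975, Thm. 5.4. [`Adams1975`]
-/

noncomputable section

open Set Function MeasureTheory
open scoped ContDiff

namespace Literature.Analysis.FluidPDE

namespace Torus

open FunctionSpaces FunctionSpaces.Torus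

variable {d : Type*} [Fintype d] [DecidableEq d] {F' : Type*} [NormedAddCommGroup F'] [InnerProductSpace ℝ F']

/-! ## Word energies -/

/-- The word energy of order `n`: `∑_{v : Fin n → d} ∫ ‖∂^v f‖²`. [cite: Majda1984, Ch. 2 §2.1 (2.8)] -/
def wordEnergy (n : ℕ) (f : UnitAddTorus d → F') : ℝ :=
  ∑ v : Fin n → d, ∫ x, ‖wordDeriv (List.ofFn v) f x‖ ^ 2

/-- The Sobolev energy of order `m`: `∑_{n ≤ m} wordEnergy n f` (the squared `H^m` norm with all
ordered words). [cite: Majda1984, Ch. 2 §2.1 (2.8)] -/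
def sobolevEnergy (m : ℕ) (f : UnitAddTorus d → F') : ℝ :=
  ∑ n ∈ Finset.range (m + 1), wordEnergy n f

/-- Word energies are nonnegative. [folklore] -/
theorem wordEnergy_nonneg (n : ℕ) (f : UnitAddTorus d → F') : 0 ≤ wordEnergy n f :=
  Finset.sum_nonneg fun _ _ => integral_nonneg fun _ => sq_nonneg _

/-- Sobolev energies are nonnegative. [folklore] -/
theorem sobolevEnergy_nonneg (m : ℕ) (f : UnitAddTorus d → F') : 0 ≤ sobolevEnergy m f :=
  Finset.sum_nonneg fun n _ => wordEnergy_nonneg n f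

/-- `E_0(f) = ∫ ‖f‖²`. [folklore] -/
theorem wordEnergy_zero (f : UnitAddTorus d → F') : wordEnergy 0 f = ∫ x, ‖f x‖ ^ 2 := by
  simp [wordEnergy]

/-- Word energies of the energies' sum: `E_m(f) ≤ sobolevEnergy m f` for `n ≤ m`. [folklore] -/
theorem wordEnergy_le_sobolevEnergy {n m : ℕ} (h : n ≤ m) (f : UnitAddTorus d → F') :
    wordEnergy n f ≤ sobolevEnergy m f :=
  Finset.single_le_sum (f := fun k => wordEnergy k f) (fun k _ => wordEnergy_nonneg k f)
    (Finset.mem_range.2 (Nat.lt_succ_of_le h))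

/-- The Sobolev energies increase with the order. [folklore] -/
theorem sobolevEnergy_mono {m m' : ℕ} (h : m ≤ m') (f : UnitAddTorus d → F') :
    sobolevEnergy m f ≤ sobolevEnergy m' f :=
  Finset.sum_le_sum_of_subset_of_nonneg (Finset.range_mono (by omega)) fun k _ _ => wordEnergy_nonneg k f

/-- A single word is dominated by the word energy of its length. [folklore] -/
theorem integral_norm_sq_wordDeriv_le_wordEnergy {n : ℕ} (v : Fin n → d) (f : UnitAddTorus d → F') :
    ∫ x, ‖wordDeriv (List.ofFn v) f x‖ ^ 2 ≤ wordEnergy n f :=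
  Finset.single_le_sum (f := fun v : Fin n → d => ∫ x, ‖wordDeriv (List.ofFn v) f x‖ ^ 2)
    (fun _ _ => integral_nonneg fun _ => sq_nonneg _) (Finset.mem_univ v)

/-- Splitting off the OUTER letter: `E_{n+1}(f) = ∑_{u} ∑ᵢ ∫ ‖∂ᵢ ∂^u f‖²`. [folklore] -/
theorem wordEnergy_succ' (n : ℕ) (f : UnitAddTorus d → F') :
    wordEnergy (n + 1) f = ∑ u : Fin n → d, ∑ i, ∫ x, ‖Torus.partialDeriv i (wordDeriv (List.ofFn u) f) x‖ ^ 2 := by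
  unfold wordEnergy
  rw [← (Fin.consEquiv fun _ : Fin (n + 1) => d).sum_comp, Fintype.sum_prod_type, Finset.sum_comm]
  refine Finset.sum_congr rfl fun u _ => Finset.sum_congr rfl fun i _ => ?_
  have : List.ofFn ((Fin.consEquiv fun _ : Fin (n + 1) => d) (i, u)) = i :: List.ofFn u := by
    simp [Fin.consEquiv]
  rw [this, wordDeriv_cons]

/-- One more outer letter: `∑ᵢ ∫ ‖∂ᵢ ∂^v f‖² ≤ E_{n+1}(f)`. [folklore] -/
theorem sum_integral_norm_sq_partialDeriv_wordDeriv_le {n : ℕ} (v : Fin n → d) (f : UnitAddTorus d → F') :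
    ∑ i, ∫ x, ‖Torus.partialDeriv i (wordDeriv (List.ofFn v) f) x‖ ^ 2 ≤ wordEnergy (n + 1) f := by
  rw [wordEnergy_succ']
  exact Finset.single_le_sum (f := fun u : Fin n → d =>
      ∑ i, ∫ x, ‖Torus.partialDeriv i (wordDeriv (List.ofFn u) f) x‖ ^ 2)
    (fun _ _ => Finset.sum_nonneg fun _ _ => integral_nonneg fun _ => sq_nonneg _) (Finset.mem_univ v)

/-- Two more outer letters: `∑ᵢⱼ ∫ ‖∂ᵢ ∂ⱼ ∂^v f‖² ≤ E_{n+2}(f)`. [folklore] -/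
theorem sum_sum_integral_norm_sq_partialDeriv₂_wordDeriv_le {n : ℕ} (v : Fin n → d) (f : UnitAddTorus d → F') :
    ∑ i, ∑ j, ∫ x, ‖Torus.partialDeriv i (Torus.partialDeriv j (wordDeriv (List.ofFn v) f)) x‖ ^ 2 ≤
      wordEnergy (n + 2) f := by
  -- `E_{n+2} = ∑_{w : Fin (n+1) → d} ∑ᵢ ∫ ‖∂ᵢ ∂^w f‖²`, and `w = cons j v` are among the `w`
  rw [wordEnergy_succ', ← (Fin.consEquiv fun _ : Fin (n + 1) => d).sum_comp, Fintype.sum_prod_type, Finset.sum_comm]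
  refine Finset.sum_le_sum fun j _ => ?_
  have e : ∀ i, Torus.partialDeriv i (Torus.partialDeriv j (wordDeriv (List.ofFn v) f)) =
      Torus.partialDeriv i (wordDeriv (List.ofFn ((Fin.consEquiv fun _ : Fin (n + 1) => d) (j, v))) f) := fun i => by
    have : List.ofFn ((Fin.consEquiv fun _ : Fin (n + 1) => d) (j, v)) = j :: List.ofFn v := by
      simp [Fin.consEquiv]
    rw [this, wordDeriv_cons]
  simp_rw [e]
  exact Finset.single_le_sum (f := fun u : Fin n → d =>
      ∑ i, ∫ x, ‖Torus.partialDeriv i (wordDeriv (List.ofFn ((Fin.consEquiv fun _ : Fin (n + 1) => d) (j, u))) f) x‖ ^ 2)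
    (fun _ _ => Finset.sum_nonneg fun _ _ => integral_nonneg fun _ => sq_nonneg _) (Finset.mem_univ v)

/-! ## The sup bound at word level -/

/-- **`‖∂^w f‖²_∞ ≤ K (E_n + E_{n+1} + E_{n+2})(f)`, `n = |w|`, on `𝕋³`** (the Sobolev embedding
`H² ⊂ L^∞` of the tree applied to `∂^w f`). [cite: Majda1984, Ch. 2 §2.1 Prop. 2.1] -/
theorem exists_norm_sq_wordDeriv_le (F' : Type*) [NormedAddCommGroup F'] [InnerProductSpace ℝ F']
    [FiniteDimensional ℝ F'] :
    ∃ K : ℝ, 0 < K ∧ ∀ (f : UnitAddTorus (Fin 3) → F'), IsSmooth f → ∀ {n : ℕ} (v : Fin n → Fin 3) (x : UnitAddTorus (Fin 3)),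
      ‖wordDeriv (List.ofFn v) f x‖ ^ 2 ≤ K * (wordEnergy n f + wordEnergy (n + 1) f + wordEnergy (n + 2) f) := by
  obtain ⟨K, hK, h⟩ := FunctionSpaces.Torus.exists_norm_sq_le_sobolev_two F'
  refine ⟨K, hK, fun f hf n v x => ?_⟩
  have hg : IsSmooth (wordDeriv (List.ofFn v) f) := isSmooth_wordDeriv hf _
  refine (h _ hg x).trans (mul_le_mul_of_nonneg_left ?_ hK.le)
  exact add_le_add (add_le_add (integral_norm_sq_wordDeriv_le_wordEnergy v f)
    (sum_integral_norm_sq_partialDeriv_wordDeriv_le v f)) (sum_sum_integral_norm_sq_partialDeriv₂_wordDeriv_le v f)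

/-- The same against the Sobolev energy: `‖∂^w f‖²_∞ ≤ 3K · sobolevEnergy m f` for `|w| + 2 ≤ m`.
[cite: Majda1984, Ch. 2 §2.1 Prop. 2.1] -/
theorem exists_norm_sq_wordDeriv_le_sobolevEnergy (F' : Type*) [NormedAddCommGroup F'] [InnerProductSpace ℝ F']
    [FiniteDimensional ℝ F'] :
    ∃ K : ℝ, 0 < K ∧ ∀ (f : UnitAddTorus (Fin 3) → F'), IsSmooth f → ∀ {n m : ℕ}, n + 2 ≤ m →
      ∀ (v : Fin n → Fin 3) (x : UnitAddTorus (Fin 3)), ‖wordDeriv (List.ofFn v) f x‖ ^ 2 ≤ K * sobolevEnergy m f := by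
  obtain ⟨K, hK, h⟩ := exists_norm_sq_wordDeriv_le F'
  refine ⟨3 * K, by positivity, fun f hf n m hnm v x => (h f hf v x).trans ?_⟩
  have h0 := wordEnergy_le_sobolevEnergy (show n ≤ m by omega) f
  have h1 := wordEnergy_le_sobolevEnergy (show n + 1 ≤ m by omega) f
  have h2 := wordEnergy_le_sobolevEnergy hnm f
  nlinarith

end Torus

end Literature.Analysis.FluidPDE

end
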